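import Summits.QuantumFields.BalabanUV.Beta.D1BFx.TorusScalarCoarseWords
import Summits.QuantumFields.BalabanUV.Beta.D1BFx.TorusArrayLimitUniform

/-!
# `BalabanUV.Beta.D1BFx.TorusScalarCoarseLimit` — road «BF-x», binder row D1, slot (K), X₃(ii) ROUTE T, brick **K-TB3c PART 2, FILE 8** «COARSE SLOT
# LIMIT» = (K4) «COARSE-2S̃−S» PART 1, third piece: **the two coarse `Tendsto` hypotheses `hc`, `hc′` of `KCombine.hessKer_transfer_road_limits`
# DISCHARGED** for the explicit coarse families of FILE 6 — along the coarse tori `Site 4 (p k)`, `p k → ∞`, fine period `s k = (m+1)·p k`,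
# `hessT ((CsqK)^; (arr (coS μ 0))^, (arr (coS ν z))^, (arr (coS₂ (s k) μ 0 ν z))^) → hessKer (CsqK (m+1) a) coS coS₂lim μ ν z`,
# by leaf-03's uniform socket `TorusArrayLimitUniform.tendsto_hessT_hessKer_of_uniform` (ruling ρ-g7-8) fed with FILE 6's letters: the first-order
# coarse family is CONSTANT in `k`, the second-order one is `k`-indexed through the wrapped two-array words, bi-localised UNIFORMLY in `k`
# (`biLoc_coW₂`) and entrywise convergent (`tendsto_coW₂`) to the `ℤ⁴`-born word.

HONEST DEPENDENCY (cell records, verbatim): «continuum YM on T⁴ ⇐ BetaPertH ∧ nine spine estimates (0/9 proved); BetaPertH ⇐ (D1) ∧ (D4) ∧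
CAP+tail; G-an2-4 gates asym, D1 and NE2/3/4.»  HONEST FRAMING (cell contract, verbatim): «discharging `BetaPertH` makes Bałaban's UV stability
UNCONDITIONAL — a real constructive-QFT result; it is NOT the continuum limit and NOT the Clay problem.»  THIS MODULE DISCHARGES NOTHING of (K),
of D1 or of the wall: [folklore] a limit bookkeeping BY NAME over leaf-03's `TorusArrayLimitUniform.tendsto_hessT_hessKer_of_uniform`, FILE 6
(`coW`, `coW₂`, `coW₂lim`, `biLoc_coW`, `biLoc_coW₂`, `tendsto_coW₂`, `rate_pos`), an2's `KernelWard.biLoc_recentre`∕`biLoc_add`,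
`SecondOrderResponse.biLoc_smul`∕`biLoc_neg`, `TameKernelCalculus.biLoc_of_le`, PART 1 `TorusGhostGram` (`CsqK`, `decays_CsqK`, `CsqK_imageShift`),
`TorusGhostLegs.tendsto_mul_period`.  Three data definitions [our object] (`coS`, `coS₂`, `coS₂lim` — the coarse FAMILIES of given fine word families;
they assert nothing); no `def … : Prop`, nothing cited, 0 sorry.  NOT D1, NOT BetaPertH, NOT continuum, NOT Clay.

ABSOLUTE RULE (cell charter, verbatim): «No internally-minted statement may enter as a cited fact. Every hypothesis is either kernel-proved in this
package or a verbatim quotation of a PUBLISHED theorem with page reference. The manuscript(s) under audit are NOT citable for their own disputed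
steps — they are the thing under adjudication; programme-internal (2001/route/tribunal) claims are never citable.»

CONTENT (d = 4; fine word families `𝒱 : Fin 4 → Site 4 → MKer 4 Unit` (first order), `𝒴 : Fin 4 → Site 4 → Fin 4 → Site 4 → MKer 4 Unit` (second order,
one-array part); leg scalar `c`; all [folklore]∕[our object]):
* §1 [our objects] `coS m a c 𝒱 μ y := −(c • coW m a (𝒱 μ y))`, `coS₂ m a c s 𝒱 𝒴 μ y ν y′ := −(c • coW m a (𝒴 μ y ν y′)) + c • coW₂ m a s (𝒱 μ y) (𝒱 ν y′)
  + c • coW₂ m a s (𝒱 ν y′) (𝒱 μ y)` (the `s`-indexed second-order coarse family), `coS₂lim` (the same with `coW₂lim`) — EXACTLY the arrays inside FILE 7's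
  `hessT_coarse_words_arr` right member at `Vs := 𝒱 μ 0`, `Vt := 𝒱 ν z`, `Y := 𝒴 μ 0 ν z`.
* §2 the letters: `biLoc_coS`, `biLoc_coS₂` (UNIFORM in `s`, anchors `(blk m 0, blk m z)`), `tendsto_coS₂_apply`.
* §3 **`tendsto_hessT_coarse_slot`** — the display above; its limit `hessKer (CsqK (m+1) a) (coS m a c 𝒱) (coS₂lim m a c 𝒱 𝒴)` is the `ℤ⁴` coarse kernel
  the re-cut END's `hK` row reads in `B12Beta.secondMoment` currency (`ScoTil`∕`Sco` at the literal's half∕full fine words — (K6c)'s instantiation).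
NOT HERE: (K4) PART 2 (the `n`-uniform bound `hCo` on that kernel's second moment); the literal's fine words; the tower∕N-side slots.
Provenance: NE9 formalisation swarm leaf seat `b2b-balaban-t4-ne9-formalise-leaf-02` gen 27 (cross-row prover duty NE9 → β∕D1 road «BF-x»; journal CLAIM
l.26220, SHAPE l.26459, owner GO l.26530), 2026-08-21.
-/

noncomputable section

namespace Summit.QuantumFields.BalabanUV.Beta.D1BFx.TorusScalarCoarseLimit

open Filter Topology Finset
open scoped BigOperators Matrix
open Literature.MathematicalPhysics.QuantumFieldTheory.Balaban1983to89
open Literature.MathematicalPhysics.QuantumFieldTheory.Balaban1983to89.Beta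
open Literature.MathematicalPhysics.QuantumFieldTheory.Balaban1983to89.B12Sec2to5 (l1 l1_nonneg)
open B6QGQLower276 (X blk)
open B6QGQDecay237 (deltaU deltaU_pos)
open B6QGGQ278Zd (deltaC deltaC_pos)
open ExpKernelCalculus (Site MKer Decays BiLoc comp hessKer)
open KernelWard (biLoc_recentre biLoc_add)
open SecondOrderResponse (biLoc_smul biLoc_neg)
open Summit.QuantumFields.BalabanUV.Beta.TameKernelCalculus (biLoc_of_le)
open Summit.QuantumFields.BalabanUV.Beta.D1BFx.FibredPeriodisation (periodiseF)
open Summit.QuantumFields.BalabanUV.Beta.D1BFx.PeriodicArrays (arr toF)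
open Summit.QuantumFields.BalabanUV.Beta.D1BFx.MixedVarPackedHess (hessT)
open Summit.QuantumFields.BalabanUV.Beta.D1BFx.TorusGhostGram (CsqK decays_CsqK CsqK_imageShift)
open Summit.QuantumFields.BalabanUV.Beta.D1BFx.TorusGhostLegs (tendsto_mul_period)
open Summit.QuantumFields.BalabanUV.Beta.D1BFx.TorusArrayLimitUniform (tendsto_hessT_hessKer_of_uniform)
open Summit.QuantumFields.BalabanUV.Beta.D1BFx.TorusScalarCoarseWords

/-! ## §1 The coarse families of given fine word families -/

section Families

variable (m : ℕ) (a c : ℝ)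

/-- [our object] **THE FIRST-ORDER COARSE FAMILY** of a fine first-order word family `𝒱`: `coS m a c 𝒱 μ y := −(c • coW m a (𝒱 μ y))`
(the array of `S̃ₛ = −Q·ĜĜ·Xₛ′·ĜĜ·Qᵀ` at leg scalar `c`; FIXED in the period).  A definition; asserts nothing. -/
def coS (𝒱 : Fin 4 → Site 4 → MKer 4 Unit) : Fin 4 → Site 4 → MKer 4 Unit := fun μ y => -(c • coW m a (𝒱 μ y))

/-- [our object] **THE `s`-INDEXED SECOND-ORDER COARSE FAMILY** of the fine families `𝒱` (first order) and `𝒴` (second order, one-array part):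
`coS₂ m a c s 𝒱 𝒴 μ y ν y′ := −(c • coW m a (𝒴 μ y ν y′)) + c • coW₂ m a s (𝒱 μ y) (𝒱 ν y′) + c • coW₂ m a s (𝒱 ν y′) (𝒱 μ y)` — the array of
`S̃ₛₜ = −Q·ĜĜ·Yₛₜ′·ĜĜ·Qᵀ + Q·ĜĜ·Xₛ′·ĜĜ·Xₜ′·ĜĜ·Qᵀ + Q·ĜĜ·Xₜ′·ĜĜ·Xₛ′·ĜĜ·Qᵀ` on the fine torus of period `s`.  A definition; asserts nothing. -/
def coS₂ (s : ℕ) (𝒱 : Fin 4 → Site 4 → MKer 4 Unit) (𝒴 : Fin 4 → Site 4 → Fin 4 → Site 4 → MKer 4 Unit) :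
    Fin 4 → Site 4 → Fin 4 → Site 4 → MKer 4 Unit :=
  fun μ y ν y' => -(c • coW m a (𝒴 μ y ν y')) + c • coW₂ m a s (𝒱 μ y) (𝒱 ν y') + c • coW₂ m a s (𝒱 ν y') (𝒱 μ y)

/-- [our object] **THE `ℤ⁴`-BORN SECOND-ORDER COARSE FAMILY** (entrywise limit of `coS₂ m a c s` as `s → ∞`): the same words with `coW₂lim`.
A definition; asserts nothing. -/
def coS₂lim (𝒱 : Fin 4 → Site 4 → MKer 4 Unit) (𝒴 : Fin 4 → Site 4 → Fin 4 → Site 4 → MKer 4 Unit) :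
    Fin 4 → Site 4 → Fin 4 → Site 4 → MKer 4 Unit :=
  fun μ y ν y' => -(c • coW m a (𝒴 μ y ν y')) + c • coW₂lim m a (𝒱 μ y) (𝒱 ν y') + c • coW₂lim m a (𝒱 ν y') (𝒱 μ y)

variable {m a c}

/-- [our object] Unfolding `coS`. -/
theorem coS_apply (𝒱 : Fin 4 → Site 4 → MKer 4 Unit) (μ : Fin 4) (y : Site 4) : coS m a c 𝒱 μ y = -(c • coW m a (𝒱 μ y)) := rfl

/-- [our object] Unfolding `coS₂`. -/
theorem coS₂_apply (s : ℕ) (𝒱 : Fin 4 → Site 4 → MKer 4 Unit) (𝒴 : Fin 4 → Site 4 → Fin 4 → Site 4 → MKer 4 Unit)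
    (μ : Fin 4) (y : Site 4) (ν : Fin 4) (y' : Site 4) :
    coS₂ m a c s 𝒱 𝒴 μ y ν y' = -(c • coW m a (𝒴 μ y ν y')) + c • coW₂ m a s (𝒱 μ y) (𝒱 ν y') + c • coW₂ m a s (𝒱 ν y') (𝒱 μ y) := rfl

/-- [our object] Unfolding `coS₂lim`. -/
theorem coS₂lim_apply (𝒱 : Fin 4 → Site 4 → MKer 4 Unit) (𝒴 : Fin 4 → Site 4 → Fin 4 → Site 4 → MKer 4 Unit)
    (μ : Fin 4) (y : Site 4) (ν : Fin 4) (y' : Site 4) :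
    coS₂lim m a c 𝒱 𝒴 μ y ν y' = -(c • coW m a (𝒴 μ y ν y')) + c • coW₂lim m a (𝒱 μ y) (𝒱 ν y') + c • coW₂lim m a (𝒱 ν y') (𝒱 μ y) := rfl

end Families

/-! ## §2 The letters of the coarse families: uniform bi-localisation at `(blk m 0, blk m z)` and the entrywise limit -/

section Letters

variable {m : ℕ} {a c : ℝ} {𝒱 : Fin 4 → Site 4 → MKer 4 Unit} {𝒴 : Fin 4 → Site 4 → Fin 4 → Site 4 → MKer 4 Unit}
  {μ ν : Fin 4} {z : Site 4} {CV CV' CY δ : ℝ}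

/-- [folklore] **THE FIRST-ORDER COARSE FAMILY IS BI-LOCALISED** at the block label of the fine word's anchor, rate `min rGG δ ∕ 16`
(FILE 6 `biLoc_coW`, rate lowered to the second-order family's). -/
theorem biLoc_coS (ha : 0 < a) {w : Site 4} (hV : BiLoc (𝒱 μ w) w w CV δ) (hδ : 0 < δ) :
    ∃ C₁ : ℝ, BiLoc (coS m a c 𝒱 μ w) (blk m w) (blk m w) C₁ (min (deltaU 4 a / (4 * ((m + 1 : ℕ) : ℝ)) / 2) δ / 4 / 4) := by
  obtain ⟨C₁, h⟩ := biLoc_coW (m := m) ha hV hδ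
  have h' := biLoc_of_le h (show min (deltaU 4 a / (4 * ((m + 1 : ℕ) : ℝ)) / 2) δ / 4 / 4 ≤ min (deltaU 4 a / (4 * ((m + 1 : ℕ) : ℝ)) / 2) δ / 4 by
    have := rate_pos (m := m) ha hδ; linarith)
  exact ⟨_, biLoc_neg (biLoc_smul c h')⟩

/-- [folklore] **THE `s`-INDEXED SECOND-ORDER COARSE FAMILY IS BI-LOCALISED UNIFORMLY IN `s`** at `(blk m 0, blk m z)`, rate `min rGG δ ∕ 16`:
ONE constant for every fine period `s ≥ 1` (FILE 6 `biLoc_coW`, `biLoc_coW₂` ×2, re-anchored by `KernelWard.biLoc_recentre`, summed). -/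
theorem biLoc_coS₂ (ha : 0 < a) (hV0 : BiLoc (𝒱 μ 0) 0 0 CV δ) (hVz : BiLoc (𝒱 ν z) z z CV' δ) (hY : BiLoc (𝒴 μ 0 ν z) 0 z CY δ) (hδ : 0 < δ) :
    ∃ C₂ : ℝ, ∀ (s : ℕ) [NeZero s],
      BiLoc (coS₂ m a c s 𝒱 𝒴 μ 0 ν z) (blk m 0) (blk m z) C₂ (min (deltaU 4 a / (4 * ((m + 1 : ℕ) : ℝ)) / 2) δ / 4 / 4) := by
  set r : ℝ := min (deltaU 4 a / (4 * ((m + 1 : ℕ) : ℝ)) / 2) δ / 4 with hr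
  have hr0 : 0 < r := rate_pos (m := m) ha hδ
  have hr4 : (0 : ℝ) ≤ r / 4 := by positivity
  obtain ⟨C₁, h₁⟩ := biLoc_coW (m := m) ha hY hδ
  obtain ⟨C₂, h₂⟩ := biLoc_coW₂ (m := m) ha hV0 hVz hδ
  obtain ⟨C₃, h₃⟩ := biLoc_coW₂ (m := m) ha hVz hV0 hδ
  have h₁' : BiLoc (-(c • coW m a (𝒴 μ 0 ν z))) (blk m 0) (blk m z) (|c| * |C₁|) (r / 4) :=
    biLoc_neg (biLoc_smul c (biLoc_of_le h₁ (by linarith)))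
  exact ⟨_, fun s _ =>
    biLoc_add (biLoc_add h₁' (biLoc_smul c (biLoc_recentre (h₂ s) hr4 (blk m (0 : X 4)) (blk m z))))
      (biLoc_smul c (biLoc_recentre (h₃ s) hr4 (blk m (0 : X 4)) (blk m z)))⟩

/-- [folklore] **THE ENTRYWISE LIMIT OF THE SECOND-ORDER COARSE FAMILY**: along any `σ k → ∞` (`σ k ≥ 1`),
`coS₂ m a c (σ k) 𝒱 𝒴 μ 0 ν z x y u v → coS₂lim m a c 𝒱 𝒴 μ 0 ν z x y u v` (FILE 6 `tendsto_coW₂` ×2; the one-array word is constant). -/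
theorem tendsto_coS₂_apply (ha : 0 < a) (hV0 : BiLoc (𝒱 μ 0) 0 0 CV δ) (hVz : BiLoc (𝒱 ν z) z z CV' δ) (hδ : 0 < δ)
    {σ : ℕ → ℕ} [∀ k, NeZero (σ k)] (hσ : Tendsto σ atTop atTop) (x y : Site 4) (u v : Unit) :
    Tendsto (fun k => coS₂ m a c (σ k) 𝒱 𝒴 μ 0 ν z x y u v) atTop (𝓝 (coS₂lim m a c 𝒱 𝒴 μ 0 ν z x y u v)) := by
  have h₂ := tendsto_coW₂ (m := m) ha hV0 hVz hδ hσ x y u v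
  have h₃ := tendsto_coW₂ (m := m) ha hVz hV0 hδ hσ x y u v
  have h := (tendsto_const_nhds (x := (-(c • coW m a (𝒴 μ 0 ν z))) x y u v)).add (((h₂.const_mul c)).add (h₃.const_mul c))
  simp only [coS₂_apply, coS₂lim_apply, Pi.add_apply, Pi.neg_apply, Pi.smul_apply, smul_eq_mul] at h ⊢
  simpa [add_assoc] using h

end Letters

/-! ## §3 The coarse slot limit -/

section Limit

variable (m : ℕ) {a : ℝ} (c : ℝ) (𝒱 : Fin 4 → Site 4 → MKer 4 Unit) (𝒴 : Fin 4 → Site 4 → Fin 4 → Site 4 → MKer 4 Unit)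
  {CV CV' CY δ : ℝ} {p : ℕ → ℕ} [∀ k, NeZero (p k)]

/-- [folklore] **(K4) PART 1 — THE COARSE SLOT LIMIT.**  For `0 < a`, a leg scalar `c`, fine word families `𝒱` (first order) and `𝒴` (second order) whose
members at the two bonds `(μ, 0)`, `(ν, z)` are bi-localised at their bonds with a common rate `δ > 0`, and coarse periods `p k → ∞` (`p k ≥ 1`), fine
periods `s k = (m+1)·p k`:
`hessT ((CsqK (m+1) a)^_{p k}; (arr (p k) (coS μ 0))^, (arr (p k) (coS ν z))^, (arr (p k) (coS₂ ((m+1)·p k) μ 0 ν z))^) → hessKer (CsqK (m+1) a) coS coS₂lim μ ν z`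
— the two coarse `Tendsto` hypotheses `hc` (at the half fine words) and `hc′` (at the full fine words) of `KCombine.hessKer_transfer_road_limits`, by
leaf-03's `TorusArrayLimitUniform.tendsto_hessT_hessKer_of_uniform` at the leg `CsqK` (`decays_CsqK`, `CsqK_imageShift`) with §2's letters. -/
theorem tendsto_hessT_coarse_slot (ha : 0 < a) (μ ν : Fin 4) (z : Site 4)
    (hV0 : BiLoc (𝒱 μ 0) 0 0 CV δ) (hVz : BiLoc (𝒱 ν z) z z CV' δ) (hY : BiLoc (𝒴 μ 0 ν z) 0 z CY δ) (hδ : 0 < δ)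
    (hp : Tendsto p atTop atTop) :
    Tendsto (fun k => hessT (Matrix.of (periodiseF (p k) (toF (CsqK (m + 1) a))))
        (Matrix.of (periodiseF (p k) (toF (arr (p k) (coS m a c 𝒱 μ 0)))))
        (Matrix.of (periodiseF (p k) (toF (arr (p k) (coS m a c 𝒱 ν z)))))
        (Matrix.of (periodiseF (p k) (toF (arr (p k) (coS₂ m a c ((m + 1) * p k) 𝒱 𝒴 μ 0 ν z))))))
      atTop (𝓝 (hessKer (CsqK (m + 1) a) (coS m a c 𝒱) (coS₂lim m a c 𝒱 𝒴) μ ν z)) := by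
  have hr16 : 0 < min (deltaU 4 a / (4 * ((m + 1 : ℕ) : ℝ)) / 2) δ / 4 / 4 := by have := rate_pos (m := m) ha hδ; positivity
  obtain ⟨C₁, h₁⟩ := biLoc_coS (m := m) (c := c) ha hV0 hδ
  obtain ⟨C₁', h₁'⟩ := biLoc_coS (m := m) (c := c) ha hVz hδ
  obtain ⟨C₂, h₂⟩ := biLoc_coS₂ (m := m) (c := c) (𝒴 := 𝒴) ha hV0 hVz hY hδ
  haveI : ∀ k, NeZero ((m + 1) * p k) := fun k => inferInstance
  exact tendsto_hessT_hessKer_of_uniform (σ := p) (decays_CsqK (m + 1) a ha) (by have := deltaC_pos 4 ha; positivity)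
    (fun k x y t u v => CsqK_imageShift (m + 1) a ha (p k) x y t u v)
    (fun _ => coS m a c 𝒱) (fun k => coS₂ m a c ((m + 1) * p k) 𝒱 𝒴) (coS m a c 𝒱) (coS₂lim m a c 𝒱 𝒴) μ ν z
    (fun _ => h₁) (fun _ => h₁') (fun k => h₂ ((m + 1) * p k)) hr16
    (fun x y u v => tendsto_const_nhds) (fun x y u v => tendsto_const_nhds)
    (fun x y u v => tendsto_coS₂_apply (m := m) (c := c) (𝒴 := 𝒴) ha hV0 hVz hδ (σ := fun k => (m + 1) * p k) (tendsto_mul_period (m + 1) hp) x y u v)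
    hp

end Limit

end Summit.QuantumFields.BalabanUV.Beta.D1BFx.TorusScalarCoarseLimit

end
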